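import Mathlib
import HarnessLib
import Summits.HubbardSuperconductivity.HubbardSuperconductivity.Theses.KLProgramme
import Summits.HubbardSuperconductivity.HubbardSuperconductivity.Theorems.KLProgrammeKLRegimeTwoPointAssemblyV7

/-!
# Route `KLProgramme` — the TWO-POINT ASSEMBLY child of the gen-3 K3 resplit, `KLRegimeTwoPointAssemblyV11`
# (`:= TwoPointAssemblyP3 klPredsV11 FinalTwoLegVolLimit klWindowC`), CLOSED BY NAME

The gen-2 child `KLRegimeTwoPointAssemblyV7` (stmt-HubbardSuperconductivity-19666) was proved by r2d-p2's composition
`TwoPointAssembly.twoPointAssemblyP3_of (Pr : Preds) (W : Set ℝ) : TwoPointAssemblyP3 Pr FinalTwoLegVolLimit W` (p456963), which is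
GENERIC in the bundle and the window: child 4/5 reads only the volume-limit slot `FinalTwoLegVolLimit` of the one frame it is handed
(free part: Riemann sums of the free propagator; interacting part: the Matsubara × momentum double limit; diagonal selection rules), never
the per-scale slots.  Hence the gen-3 twin at `klPredsV11` closes by the same theorem, instantiated.  One theorem; nothing else.
(Seat hubbard-kl-k3c5-p1 g2 — row (b) child 5 «stub_asm_matsubara suppliers» — filing the re-closure of its own row's child as announced
on HOME/STATUS; r2d-p2's composition is the content.)
-/

noncomputable section

namespace Summit.HubbardSuperconductivity.HubbardSuperconductivity.Theorems.TwoPointAssembly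

set_option linter.dupNamespace false -- summit = problem name (single-conjunct summit), D-0017

open Summit.HubbardSuperconductivity.HubbardSuperconductivity.Theorems.KLRegimeSplit

/-- **The two-point assembly child of the gen-3 K3 resplit, BY NAME**: `TwoPointAssemblyP3 klPredsV11 FinalTwoLegVolLimit klWindowC`,
an instance of the bundle-generic composition `twoPointAssemblyP3_of`. -/
theorem KLRegimeTwoPointAssemblyV11_of :
    Summit.HubbardSuperconductivity.HubbardSuperconductivity.Theses.KLProgramme.KLRegimeTwoPointAssemblyV11 :=
  twoPointAssemblyP3_of _ _

end Summit.HubbardSuperconductivity.HubbardSuperconductivity.Theorems.TwoPointAssembly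

end
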